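import Literature.AlgebraicGeometry.ModuliOfAbelianVarieties.SiegelModuliDatum   -- ★ `siegelPeriodMap`, `siegelPeriodEquiv`, `I_smul_one_mem_siegelUpperHalfSpace`
import Literature.Geometry.Kaehler.AnalyticSet                                   -- ★ `mdifferentiableOn_pi_space`
import Mathlib.Geometry.Manifold.MFDeriv.SpecificFunctions
import HarnessLib

/-!
# The TAUTOLOGICAL PERIOD FAMILY `t ↦ Π_{s t}` along a holomorphic lift `s : T^an ⊇ U → 𝔥_g`
# ([Lange2023AbelianVarietiesComplex] §3.4.1 (3.11) `j_Z : ℝ^{2g} → ℂ^g, x ↦ (Z, 1_g)x`; [BirkenhakeLange2004] §8.1, Ch. 8)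

Layer `Literature/AlgebraicGeometry/ModuliOfAbelianVarieties`, namespace
`Literature.AlgebraicGeometry.ModuliOfAbelianVarieties.SiegelModuli`.  THEOREMS ONLY (no `def`, no named fact, no
`sorry`, no instance, no notation).  Cell `hodgecm-mathlib` (D-0151), FLOOR 0, P6 «MOD», crux hLiu418 =
stmt-HodgeConjecture-24832 (`--supports`), half A line L7 (socket `stub_UNIVFAM` of
`Cruxes/HLiu418/Lines/F0_P6a_PELWitnessE.lean`, printed letter P-3 «UNIV-FAMILY» ★
`siegelUniversalFamilyUniformisation`).  HC_CM is proved only modulo the printed citations until rung 0 closes;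
this file is generic plumbing and changes no count.

THE MATHEMATICS.  In print the universal family over `𝔥_g` is `𝔛_D = (ℂ^g × 𝔥_g) ∕ Λ_D` with `Λ_D` acting through
`j_Z(ℓ) = Zℓ¹ + Δℓ²` ([Lange2023AbelianVarietiesComplex] §3.4.1 (3.11), Prop. 3.4.1; [BirkenhakeLange2004] §8.1
Prop. 8.1.1, §8.7): the PERIOD FAMILY of the universal family is the TAUTOLOGICAL one, `Z ↦ j_Z = (Z, Δ)` (the tree's
★ `siegelPeriodMap δ Z`), and along a holomorphic map `s : U → 𝔥_g` from a complex manifold the pulled-back family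
has period family `t ↦ j_{s t}`, holomorphic in `t` because `s` is.  The conclusion of ★ P-3
`siegelUniversalFamilyUniformisation` asks for exactly such a family as a function
`Φ : MT → ((Fin g ⊕ Fin g → ℝ) ≃L[ℝ] (Fin g → ℂ))` on the WHOLE analytification `MT` (equal to `Π_{s t}` on the
open `U` of the lift) together with the `mdifferentiableOn_period` clause of ★ `IsRelExpChartOn` (C).  This file
pays that part once and for all, for ANY complex model `I` of the base:

* `mdifferentiableOn_siegelPeriodMap_apply` — if every entry `t ↦ s t i j` is holomorphic on `U`, then so is
  `t ↦ siegelPeriodMap δ (s t) x` for every real vector `x` (componentwise: ★ `mdifferentiableOn_pi_space`; each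
  component is a finite sum of products of holomorphic functions with constants);
* `exists_periodFamily_eq_siegelPeriodMap` — for `δᵢ ≥ 1` and `s t ∈ 𝔥_g` on `U` there IS a family of real-linear
  ISOMORPHISMS `Φ : M → (ℝ^{2g} ≃L[ℝ] ℂ^g)` with `Φ t v = siegelPeriodMap δ (s t) v` for `t ∈ U` (★ `siegelPeriodEquiv`
  on `U`, the principally marked point `i·1_g` ★ `I_smul_one_mem_siegelUpperHalfSpace` off `U`), hence holomorphic
  periods on `U` — the first conjunct of P-3's conclusion and the period field of its chart clause (C), verbatim
  shape at `I = 𝓘(ℂ, Fin d → ℂ)`;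
* `periodFamily_eq_siegelPeriodEquiv` — any such `Φ` agrees on `U` with ★ `siegelPeriodEquiv hδ (hs t ht)` (so its
  lattice `Φ t (ℤ^{2g})` is `(s t)ℤ^g ⊕ Δℤ^g` and its torus is the marked torus `X_{s t}` of the tree).

## References
* [Lange2023AbelianVarietiesComplex] H. Lange, *Abelian Varieties over the Complex Numbers*, Grundlehren Text Edition
  (2023), §3.4.1 (3.11) and Prop. 3.4.1 p. 186 (held copy `book:lange1992-complex-abelian-varieties`, chunk p0180).
* [BirkenhakeLange2004] C. Birkenhake, H. Lange, *Complex Abelian Varieties*, 2nd ed. (2004), §8.1 Prop. 8.1.1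
  (`X_Z = ℂ^g ∕ (Z, D)ℤ^{2g}`), §8.7 (the universal family over `𝔥_g`).
* [LangeBirkenhake1992] H. Lange, Ch. Birkenhake, *Complex Abelian Varieties* (1992), §8.1 (Prop. 8.1.1).
-/

set_option autoImplicit false

noncomputable section

open scoped Manifold
open Set

namespace Literature.AlgebraicGeometry.ModuliOfAbelianVarieties

namespace SiegelModuli

open Literature.NumberTheory.Automorphic (siegelUpperHalfSpace)

variable {EM : Type*} [NormedAddCommGroup EM] [NormedSpace ℂ EM] {H : Type*} [TopologicalSpace H]
  {I : ModelWithCorners ℂ EM H} {M : Type*} [TopologicalSpace M] [ChartedSpace H M]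
  {g : ℕ} {δ : Fin g → ℕ}

/-- Finite sums of holomorphic vector-valued maps on a set are holomorphic there (plumbing; Mathlib has `add` only).
[folklore] -/
private theorem mdifferentiableOn_finset_sum {F : Type*} [NormedAddCommGroup F] [NormedSpace ℂ F] {κ : Type*}
    (t : Finset κ) {f : κ → M → F} {U : Set M}
    (hf : ∀ k ∈ t, MDifferentiableOn I 𝓘(ℂ, F) (f k) U) :
    MDifferentiableOn I 𝓘(ℂ, F) (fun b ↦ ∑ k ∈ t, f k b) U := by
  classical
  induction t using Finset.induction_on with
  | empty => simpa using mdifferentiableOn_const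
  | insert k t hk ih =>
    have h1 : MDifferentiableOn I 𝓘(ℂ, F) (f k + fun b ↦ ∑ k ∈ t, f k b) U :=
      (hf k (Finset.mem_insert_self k t)).add (ih fun k' hk' ↦ hf k' (Finset.mem_insert_of_mem hk'))
    refine h1.congr fun b _ ↦ ?_
    simp [Finset.sum_insert hk]

/-- **The tautological period vectors are holomorphic along a holomorphic lift**: if every entry `t ↦ s t i j` of
`s : M → Matrix (Fin g) (Fin g) ℂ` is holomorphic on `U`, then for every real vector `x ∈ ℝ^g ⊕ ℝ^g` the period vector
`t ↦ Π_{s t}(x) = (s t) x¹ + Δ x²` (★ `siegelPeriodMap δ (s t) x`) is holomorphic on `U` — `j_Z(x) = (Z, 1_g)x` of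
(3.11) depends holomorphically (indeed affinely) on `Z`.
[cite: Lange2023AbelianVarietiesComplex, §3.4.1 (3.11) and Prop. 3.4.1 p. 186] [cite: BirkenhakeLange2004, §8.1 Prop. 8.1.1] -/
theorem mdifferentiableOn_siegelPeriodMap_apply (δ : Fin g → ℕ) {s : M → Matrix (Fin g) (Fin g) ℂ} {U : Set M}
    (hs : ∀ i j, MDifferentiableOn I 𝓘(ℂ, ℂ) (fun t => s t i j) U) (x : Fin g ⊕ Fin g → ℝ) :
    MDifferentiableOn I 𝓘(ℂ, Fin g → ℂ) (fun t => siegelPeriodMap δ (s t) x) U := by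
  refine (Literature.Geometry.Kaehler.mdifferentiableOn_pi_space (I := I) (F := fun _ : Fin g => ℂ)).2 fun i => ?_
  have h : (fun t => siegelPeriodMap δ (s t) x i) =
      fun t => (∑ j, s t i j * (x (Sum.inl j) : ℂ)) + (δ i : ℂ) * (x (Sum.inr i) : ℂ) := by
    funext t
    exact siegelPeriodMap_apply δ (s t) x i
  rw [h]
  refine MDifferentiableOn.add ?_ mdifferentiableOn_const
  exact mdifferentiableOn_finset_sum (I := I) Finset.univ fun j _ => (hs i j).mul mdifferentiableOn_const

/-- **THE TAUTOLOGICAL PERIOD FAMILY EXISTS AS A FAMILY OF REAL-LINEAR ISOMORPHISMS, HOLOMORPHIC ON THE LIFT'S OPEN**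
(the first conjunct of the conclusion of ★ P-3 `siegelUniversalFamilyUniformisation` and the `mdifferentiableOn_period`
field of its chart clause (C), for ANY complex model `I` of the base): for a polarisation type with `δᵢ ≥ 1`, an open
`U ⊆ M` and `s : M → Matrix (Fin g) (Fin g) ℂ` with `s t ∈ 𝔥_g` for `t ∈ U` and holomorphic entries on `U`, there is
`Φ : M → ((Fin g ⊕ Fin g → ℝ) ≃L[ℝ] (Fin g → ℂ))` with `Φ t v = siegelPeriodMap δ (s t) v` for all `t ∈ U` and all `v`,
and `t ↦ Φ t x` holomorphic on `U` for every `x`.  (On `U` it is the period isomorphism ★ `siegelPeriodEquiv` of the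
marked torus `X_{s t} = ℂ^g ∕ (s t, Δ)ℤ^{2g}`; off `U` the principally marked point `i·1_g` is used — P-3 constrains
`Φ` on `U` only.)
[cite: Lange2023AbelianVarietiesComplex, §3.4.1 (3.11) and Prop. 3.4.1 p. 186] [cite: BirkenhakeLange2004, §8.1 Prop. 8.1.1, §8.7] -/
theorem exists_periodFamily_eq_siegelPeriodMap (hδ : ∀ i, 0 < δ i) {s : M → Matrix (Fin g) (Fin g) ℂ} {U : Set M}
    (hsU : ∀ t ∈ U, s t ∈ siegelUpperHalfSpace g) (hs : ∀ i j, MDifferentiableOn I 𝓘(ℂ, ℂ) (fun t => s t i j) U) :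
    ∃ Φ : M → ((Fin g ⊕ Fin g → ℝ) ≃L[ℝ] (Fin g → ℂ)),
      (∀ t ∈ U, ∀ v : Fin g ⊕ Fin g → ℝ, Φ t v = siegelPeriodMap δ (s t) v) ∧
      ∀ x : Fin g ⊕ Fin g → ℝ, MDifferentiableOn I 𝓘(ℂ, Fin g → ℂ) (fun t => Φ t x) U := by
  classical
  refine ⟨fun t => if ht : t ∈ U then siegelPeriodEquiv hδ (hsU t ht)
      else siegelPeriodEquiv hδ (I_smul_one_mem_siegelUpperHalfSpace g), ?_, ?_⟩
  · intro t ht v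
    simp only [dif_pos ht, siegelPeriodEquiv_apply]
  · intro x
    refine (mdifferentiableOn_siegelPeriodMap_apply (I := I) δ hs x).congr fun t ht => ?_
    simp only [dif_pos ht, siegelPeriodEquiv_apply]

omit [TopologicalSpace M] in
/-- **On the lift's open any tautological period family IS the tree's Siegel period isomorphism** `siegelPeriodEquiv hδ _`
at `s t` (as continuous linear equivalences) — so its lattice is `(s t)ℤ^g ⊕ Δℤ^g` and its fibre torus is the marked torus
`X_{s t}` of ★ `SiegelUniversalFamily`, with no further bookkeeping.
[cite: BirkenhakeLange2004, §8.1 Prop. 8.1.1] [cite: Lange2023AbelianVarietiesComplex, §3.4.1 Prop. 3.4.1 p. 186] -/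
theorem periodFamily_eq_siegelPeriodEquiv (hδ : ∀ i, 0 < δ i) {s : M → Matrix (Fin g) (Fin g) ℂ} {U : Set M}
    (hsU : ∀ t ∈ U, s t ∈ siegelUpperHalfSpace g) {Φ : M → ((Fin g ⊕ Fin g → ℝ) ≃L[ℝ] (Fin g → ℂ))}
    (hΦ : ∀ t ∈ U, ∀ v : Fin g ⊕ Fin g → ℝ, Φ t v = siegelPeriodMap δ (s t) v) {t : M} (ht : t ∈ U) :
    Φ t = siegelPeriodEquiv hδ (hsU t ht) := by
  ext v i
  rw [hΦ t ht v, siegelPeriodEquiv_apply]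

omit [TopologicalSpace M] in
/-- **Two tautological period families agree on the lift's open** (P-3 pins `Φ` on `U` only; any two choices are
interchangeable there). [cite: BirkenhakeLange2004, §8.1 Prop. 8.1.1] -/
theorem periodFamily_eq_of_eq_siegelPeriodMap {s : M → Matrix (Fin g) (Fin g) ℂ} {U : Set M}
    {Φ Φ' : M → ((Fin g ⊕ Fin g → ℝ) ≃L[ℝ] (Fin g → ℂ))}
    (hΦ : ∀ t ∈ U, ∀ v : Fin g ⊕ Fin g → ℝ, Φ t v = siegelPeriodMap δ (s t) v)
    (hΦ' : ∀ t ∈ U, ∀ v : Fin g ⊕ Fin g → ℝ, Φ' t v = siegelPeriodMap δ (s t) v) {t : M} (ht : t ∈ U) :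
    Φ t = Φ' t := by
  ext v i
  rw [hΦ t ht v, hΦ' t ht v]

omit [TopologicalSpace M] in
/-- **The lattice of the tautological period family at `t ∈ U` is `(s t)ℤ^g ⊕ Δℤ^g`**: for an integer vector `n`,
`Φ t n = (s t) n¹ + Δ n²` (the kernel clause of ★ `IsRelExpChartOn` reads through this).
[cite: Lange2023AbelianVarietiesComplex, §3.4.1 (3.11) p. 186] -/
theorem periodFamily_apply_intCast {s : M → Matrix (Fin g) (Fin g) ℂ} {U : Set M}
    {Φ : M → ((Fin g ⊕ Fin g → ℝ) ≃L[ℝ] (Fin g → ℂ))}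
    (hΦ : ∀ t ∈ U, ∀ v : Fin g ⊕ Fin g → ℝ, Φ t v = siegelPeriodMap δ (s t) v) {t : M} (ht : t ∈ U)
    (n : Fin g ⊕ Fin g → ℤ) (i : Fin g) :
    Φ t (fun k => (n k : ℝ)) i = (∑ j, s t i j * (n (Sum.inl j) : ℂ)) + (δ i : ℂ) * (n (Sum.inr i) : ℂ) := by
  rw [hΦ t ht, siegelPeriodMap_apply]
  simp only [Complex.ofReal_intCast]

end SiegelModuli

end Literature.AlgebraicGeometry.ModuliOfAbelianVarieties

end
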